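import Summits.QuantumFields.YangMills.Theorems.HyperbolicRegulatorCurvatureAnchorRDefs

/-!
# Route `HyperbolicRegulator`, crux `CurvatureAnchorR` (stmt-QuantumFields-18155): the two crux-sized hypotheses of line
# `witten_hessian`, NAMED

Second route-posited Defs file of the line (lead `prover-line-stmt-QuantumFields-18155-0`).  After wave 1 of the line the
stubs `stub_ct` (`…StubCt`, p173035), `stub_kunneth` (`…StubKunneth`, p174031) and `stub_instantiate`
(`…StubInstantiate`, p173947) are LANDED theorems; what remains of the registered skeleton
`Cruxes/CurvatureAnchorR/Lines/witten_hessian.lean` are exactly two statements, both judged crux-sized: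

* `TowersHyp` — VERBATIM the statement of `stub_towers` (log-girth expander square towers: an `AdmR`-admissible, tame,
  diameter-dominated, coherently oriented, dual-Poincaré family for every `k ≥ 8` and every `j`).  Assessment
  `Cruxes/CurvatureAnchorR/Lines/witten_hessian-stub_towers-assessment.md`: needs a uniform spectral gap for congruence
  covers of the arithmetic `(2,4,5)` surface (Jacquet–Langlands/Vignéras) transferred to the tiling graphs (Brooks 1986,
  Mantuano 2005) and logarithmic systole (Katz–Schaps–Vishne 2007), none of which is in the tree — to be promoted to items.
* `MixingHyp` — VERBATIM the statement of `stub_mixing` (contractible-support exponential mixing at giant `β`, `j`-uniform,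
  for every admissible tame Künneth-gapped family, given `CombesThomasSqrt`): the open analytic core of the crux.

Naming them (i) lets the reshaped skeleton register `stub_towers : TowersHyp` / `stub_mixing : MixingHyp` with signatures
short enough for the gate's name + signature match (the registrar truncates a signature at its first `:=`, which for the
`letI : MeasurableSpace G := borel G` binder of `stub_mixing` made the verbatim form unmatchable), and (ii) lets the
reduction `TowersHyp → MixingHyp → CurvatureAnchorR` land as a sorry-free theorem
(`Theorems/HyperbolicRegulatorCurvatureAnchorRReduction.lean`).  NOTHING is asserted here: two definitions, no lemma.
Both bodies are byte for byte the registered stub statements of skeleton sha `4cd50c98…` (= `c8040c64…` with the Defs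
import), themselves unchanged since the strategist's registration.
-/

set_option autoImplicit false

noncomputable section

namespace Summit.QuantumFields.YangMills.Cruxes.CurvatureAnchorR.WittenHessian

open scoped BigOperators Topology Manifold Classical MeasureTheory ProbabilityTheory Matrix InnerProductSpace ComplexConjugate ContinuousMap
open Filter Set Function TopologicalSpace MeasureTheory
open Literature.MathematicalPhysics.QuantumFieldTheory Literature.MathematicalPhysics.QuantumLattice
open Summit.QuantumFields.YangMills.Theses.HyperbolicRegulator

/-- **`TowersHyp` — log-girth expander square towers** (VERBATIM the statement of the registered stub `stub_towers` of
line `witten_hessian`): there are `C_T` and a family `S_(k,j)` of finite square complexes such that for every `k ≥ 8` and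
every `j`: `AdmR k j` (the crux's admissibility), tameness `Tame L` at a scale `L ≥ j` which dominates the diameter
(`dist x y ≤ C_T · L` on `V`), coherent square orientations `Coh`, and the dual Poincaré inequality `DualPoinc k`.
Crux-sized (assessment file of the line); intended witness: `k`-subdivided congruence covers of the `{4,5}` tiling of the
arithmetic `(2,4,5)` surface.  A hypothesis, not a claim. -/
def TowersHyp : Prop :=
  ∃ (CT : ℕ) (V E Q : ℕ → ℕ → Finset ℕ) (σ τ : ℕ → ℕ → ℕ → ℕ) (bd : ℕ → ℕ → ℕ → Fin 4 → ℕ × Bool) (cV : ℕ → ℕ → ℕ → ℤ × ℤ → ℕ) (cE : ℕ → ℕ → ℕ → ℤ × ℤ → Fin 2 → ℕ × Bool), ∀ k j : ℕ, 8 ≤ k → AdmR k j (V k j) (E k j) (Q k j) (σ k j) (τ k j) (bd k j) (cV k j) (cE k j) ∧ (∃ L : ℕ, j ≤ L ∧ Tame L (V k j) (E k j) (Q k j) (σ k j) (τ k j) (bd k j) ∧ ∀ x ∈ V k j, ∀ y ∈ V k j, (SimpleGraph.fromRel fun a b : ℕ => ∃ e ∈ E k j, σ k j e = a ∧ τ k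 j e = b).dist x y ≤ CT * L) ∧ Coh (Q k j) (bd k j) ∧ DualPoinc k (E k j) (Q k j) (bd k j)

set_option linter.unusedVariables false in -- verbatim registered statement: its shared `let`-prefix binds `Sp`, unused in this stub
/-- **`MixingHyp` — contractible-support exponential mixing at giant `β`, `j`-uniform** (VERBATIM the statement of the
registered stub `stub_mixing` of line `witten_hessian`; the open analytic core of the crux): given `CombesThomasSqrt`, for
every compact simple `G`, faithful unitary `r`, every `C_T` and every family that is `AdmR`-admissible for all `k ≥ 8`,
tame at a diameter-dominating scale `L ≥ j` and Künneth-gapped, there is ONE `c > 0` such that for every `k ≥ 8` there is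
`β₀` and for every `β ≥ β₀` one constant `Kc` with, for all `j ≥ k`, `|X(fg) − X f · X g| ≤ Kc‖f‖∞‖g‖∞e^{−(c/k)(dist a a′ +
dist b b′)}` for all bounded measurable cylinder functions `f, g` of the links within `⌊k/2⌋` of product vertices
`(a,b), (a′,b′) ∈ V × V` with `2k < dist a a′ + dist b b′`, under the crux's Wilson–Gibbs ratio `X` (same `S`, `ν` as the
crux, byte-identical lets).  A hypothesis, not a claim (unprinted for non-abelian `G`; see the skeleton docstring §1–§4
for the intended Helffer–Sjöstrand / Witten-Laplacian route and why it might fail). -/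
def MixingHyp : Prop :=
  open Literature.MathematicalPhysics.QuantumFieldTheory Literature.MathematicalPhysics.QuantumLattice MeasureTheory in ∀ (G : Type) [Group G] [TopologicalSpace G] [IsTopologicalGroup G] [CompactSpace G], IsCompactSimpleLieGroup G → letI : MeasurableSpace G := borel G; haveI : BorelSpace G := ⟨rfl⟩; ∀ r : LatticeRep G, let Fam := fun (k j : ℕ) (V E Q : Finset ℕ) (σ τ : ℕ → ℕ) (bd : ℕ → Fin 4 → ℕ × Bool) (cV : ℕ → ℤ × ℤ → ℕ) (cE : ℕ → ℤ × ℤ → Fin 2 → ℕ × Bool) => let st := fun e : ℕ × Bool => if e.2 then σ e.1 else τ e.1; let en := fun e : ℕ × Bool => if e.2 then τ e.1 else σ e.1; let Γ := SimpleGraph.fromRel fun a b : ℕ => ∃ e ∈ E, σ e = a ∧ τ e = b; let dg := fun x : ℕ => (E.filter fun e => σ e = x ∨ τ e = x).card; let K := V.filter fun x => dg x = 5; let F := fun x : ℕ => x ∈ V ∧ ∀ c ∈ K, k / 2 < Γ.dist x c; let Dp := fun x : ℕ => x ∈ V ∧ ∀ c ∈ K, 3 * (k / 4) < Γ.dist x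 c; let ib := fun a : ℤ × ℤ => |a.1| ≤ (k : ℤ) / 4 ∧ |a.2| ≤ (k : ℤ) / 4; let nx := fun (a : ℤ × ℤ) (μ : Fin 2) => if μ = 0 then (a.1 + 1, a.2) else (a.1, a.2 + 1); let Ed := (ℕ × ℕ) ⊕ (ℕ × ℕ); let PE : Finset Ed := (E ×ˢ V).disjSum (V ×ˢ E); let Cfg := ↥PE → G; let ν := Measure.pi fun _ : ↥PE => haarProbability G; let v := fun (U : Cfg) (e : Ed × Bool) => if h : e.1 ∈ PE then (if e.2 then U ⟨e.1, h⟩ else (U ⟨e.1, h⟩)⁻¹) else 1; let w := fun (U : Cfg) (e : Fin 4 → Ed × Bool) => (r.ρ (v U (e 0) * v U (e 1) * v U (e 2) * v U (e 3))).trace.re; let S := fun U : Cfg => (∑ q ∈ Q, ∑ y ∈ V, w U fun i => (Sum.inl ((bd q i).1, y), (bd q i).2)) + (∑ y ∈ V, ∑ q ∈ Q, w U fun i => (Sum.inr (y, (bd q i).1), (bd q i).2)) + ∑ e ∈ E, ∑ e' ∈ E, w U ![(Sum.inl (e, σ e'), true), (Sum.inr (τ e, e'), true), (Sum.inl (e,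 τ e'), false), (Sum.inr (σ e, e'), false)]; let d0 : Fin 4 → Fin 2 := ![0, 1, 0, 1]; let P := fun (x x' : ℕ) (U : Cfg) (p : ZdEdge 4) => let a := (p.1 0, p.1 1); let b := (p.1 2, p.1 3); if p.2 = 0 ∨ p.2 = 1 then v U (Sum.inl ((cE x a (d0 p.2)).1, cV x' b), (cE x a (d0 p.2)).2) else v U (Sum.inr (cV x a, (cE x' b (d0 p.2)).1), (cE x' b (d0 p.2)).2); ((∀ e ∈ E, σ e ∈ V ∧ τ e ∈ V ∧ σ e ≠ τ e) ∧ (∀ q ∈ Q, (∀ i, (bd q i).1 ∈ E) ∧ (∀ i, en (bd q i) = st (bd q (i + 1))) ∧ (st ∘ bd q).Injective) ∧ (∀ e ∈ E, (Q.filter fun q => ∃ i, (bd q i).1 = e).card = 2) ∧ (∀ x ∈ V, (dg x = 4 ∨ dg x = 5) ∧ (Q.filter fun q => ∃ i, st (bd q i) = x).card = dg x) ∧ (∀ x ∈ V, ∃ c ∈ K, Γ.dist x c ≤ k) ∧ (∀ c ∈ K, ∀ c' ∈ K, c ≠ c' → k ≤ Γ.dist c c') ∧ (∀ f : ℕ →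 ℝ, ∑ x ∈ V, f x = 0 → ∑ x ∈ V, f x ^ 2 ≤ 10 ^ 6 * (k : ℝ) ^ 2 * ∑ e ∈ E, (f (σ e) - f (τ e)) ^ 2) ∧ (∃ x y, Dp x ∧ Dp y ∧ j ≤ Γ.dist x y) ∧ (∀ x, F x → cV x (0, 0) = x ∧ (∀ a, ib a → cV x a ∈ V) ∧ Set.InjOn (cV x) {a | ib a} ∧ (∀ a μ, ib a → ib (nx a μ) → (cE x a μ).1 ∈ E ∧ st (cE x a μ) = cV x a ∧ en (cE x a μ) = cV x (nx a μ)) ∧ (∀ a, ib a → ib (a.1 + 1, a.2 + 1) → ∃ q ∈ Q, Finset.univ.image (Prod.fst ∘ bd q) = {(cE x a 0).1, (cE x (nx a 0) 1).1, (cE x (nx a 1) 0).1, (cE x a 1).1})), fun (β m C : ℝ) (A B : YMSpecies G) => let X := fun f : Cfg → ℝ => (∫ U, f U * Real.exp (β * S U) ∂ν) / (∫ U, Real.exp (β * S U) ∂ν); ∀ x x' y y', F x → F x' → F y → F y' → |X (fun U => A.F (P x x' U) * B.F (P y y' U)) - X (fun U => A.F (P x x' U)) * X (fun U => B.F (P y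 y' U))| ≤ C * Real.exp (-(m * ((Γ.dist x y + Γ.dist x' y' : ℕ) : ℝ)))); let Sp := fun (A : YMSpecies G) (R : ℕ) => ∀ p ∈ A.supp, ∀ i, |p.1 i| ≤ (R : ℤ); let Mix := fun (k : ℕ) (V E Q : Finset ℕ) (σ τ : ℕ → ℕ) (bd : ℕ → Fin 4 → ℕ × Bool) => let Γ := SimpleGraph.fromRel fun a b : ℕ => ∃ e ∈ E, σ e = a ∧ τ e = b; let Ed := (ℕ × ℕ) ⊕ (ℕ × ℕ); let PE : Finset Ed := (E ×ˢ V).disjSum (V ×ˢ E); let Cfg := ↥PE → G; let ν := Measure.pi fun _ : ↥PE => haarProbability G; let v := fun (U : Cfg) (e : Ed × Bool) => if h : e.1 ∈ PE then (if e.2 then U ⟨e.1, h⟩ else (U ⟨e.1, h⟩)⁻¹) else 1; let w := fun (U : Cfg) (e : Fin 4 → Ed × Bool) => (r.ρ (v U (e 0) * v U (e 1) * v U (e 2) * v U (e 3))).trace.re; let S := fun U : Cfg => (∑ q ∈ Q, ∑ y ∈ V, w U fun i => (Sum.inl ((bd q i).1, y), (bd q i).2)) + (∑ y ∈ V, ∑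 q ∈ Q, w U fun i => (Sum.inr (y, (bd q i).1), (bd q i).2)) + ∑ e ∈ E, ∑ e' ∈ E, w U ![(Sum.inl (e, σ e'), true), (Sum.inr (τ e, e'), true), (Sum.inl (e, τ e'), false), (Sum.inr (σ e, e'), false)]; let nr := fun (a b : ℕ) (l : Ed) => Sum.elim (fun p : ℕ × ℕ => Γ.dist a (σ p.1) ≤ k / 2 ∧ Γ.dist a (τ p.1) ≤ k / 2 ∧ Γ.dist b p.2 ≤ k / 2) (fun p : ℕ × ℕ => Γ.dist a p.1 ≤ k / 2 ∧ Γ.dist b (σ p.2) ≤ k / 2 ∧ Γ.dist b (τ p.2) ≤ k / 2) l; let Cyl := fun (a b : ℕ) (f : Cfg → ℝ) => ∀ U U' : Cfg, (∀ (l : Ed) (h : l ∈ PE), nr a b l → U ⟨l, h⟩ = U' ⟨l, h⟩) → f U = f U'; fun (β m Kc : ℝ) => let X := fun f : Cfg → ℝ => (∫ U, f U * Real.exp (β * S U) ∂ν) / (∫ U, Real.exp (β * S U) ∂ν); ∀ (a b a' b' : ℕ) (f g : Cfg → ℝ) (Mf Mg : ℝ), a ∈ V → b ∈ V → a' ∈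 V → b' ∈ V → Cyl a b f → Cyl a' b' g → Measurable f → Measurable g → (∀ U, |f U| ≤ Mf) → (∀ U, |g U| ≤ Mg) → 2 * k < Γ.dist a a' + Γ.dist b b' → |X (fun U => f U * g U) - X f * X g| ≤ Kc * Mf * Mg * Real.exp (-(m * ((Γ.dist a a' + Γ.dist b b' : ℕ) : ℝ))); CombesThomasSqrt → ∀ (CT : ℕ) (V E Q : ℕ → ℕ → Finset ℕ) (σ τ : ℕ → ℕ → ℕ → ℕ) (bd : ℕ → ℕ → ℕ → Fin 4 → ℕ × Bool) (cV : ℕ → ℕ → ℕ → ℤ × ℤ → ℕ) (cE : ℕ → ℕ → ℕ → ℤ × ℤ → Fin 2 → ℕ × Bool), let Φ := fun k j => Fam k j (V k j) (E k j) (Q k j) (σ k j) (τ k j) (bd k j) (cV k j) (cE k j); let Ψ := fun k j => Mix k (V k j) (E k j) (Q k j) (σ k j) (τ k j) (bd k j); (∀ k j, 8 ≤ k → (Φ k j).1) → (∀ k j, 8 ≤ k → ∃ L : ℕ, j ≤ L ∧ Tame L (V k j) (E k j) (Q k j) (σ k j) (τ k j) (bd k j) ∧ ∀ x ∈ V k j,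 ∀ y ∈ V k j, (SimpleGraph.fromRel fun a b : ℕ => ∃ e ∈ E k j, σ k j e = a ∧ τ k j e = b).dist x y ≤ CT * L) → (∀ k j, 8 ≤ k → KunnethGap k (V k j) (E k j) (Q k j) (σ k j) (τ k j) (bd k j)) → ∃ c : ℝ, 0 < c ∧ ∀ k, 8 ≤ k → ∃ β₀ : ℝ, ∀ β, β₀ ≤ β → ∃ Kc : ℝ, ∀ j, k ≤ j → Ψ k j β (c / k) Kc

end Summit.QuantumFields.YangMills.Cruxes.CurvatureAnchorR.WittenHessian

end
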